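import Mathlib
import Summits.BirchSwinnertonDyer.BirchSwinnertonDyer.Theorems.ResidualThetaTransportAtTwoSignedMuSeedAtTwoPlusNonsquareDescentRankOneCertificate
import Summits.BirchSwinnertonDyer.BirchSwinnertonDyer.Theorems.ResidualThetaTransportAtTwoSignedMuSeedAtTwoPlusNonsquareDescentGrowthCertificate
import Summits.BirchSwinnertonDyer.BirchSwinnertonDyer.Theorems.ResidualThetaTransportAtTwoSignedMuSeedAtTwoPlusNonsquareDescentGrowthDichotomy
import Literature.NumberTheory.IwasawaTheory.ClassicalMuVanishesDescent
import HarnessLib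

/-!
# Non-square descent — «GNS AT ONE LEVEL ⟹ LINEAR GROWTH OF `#(Q'/ω_nQ')`», ONE THEOREM (S3 (c) certificate ∘ growth lemma at `μ = 0`) — seed crux
# `SignedMuSeedAtTwoPlus` stmt-BirchSwinnertonDyer-21438 (parent Kμ⁺ `SignedMuVanishingAtTwoPlus` stmt-BirchSwinnertonDyer-20689, route
# ResidualThetaTransportAtTwo), line card `Cruxes/SignedMuSeedAtTwoPlus/Lines/nonsquare-descent.md` (S3 ⟹ S2's growth input)

Cell `bsd-wall`, width seat `bsd-wall-rtt-p4-w2` g18 (`--supports`, closes nothing).  THEOREMS ONLY; BSD is not proved by this and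
nothing arithmetic is asserted: composition of module algebra already in the tree.

The card argues «GNS(m) for ONE `m` ⟹ `μ(Q') = 0` ⟹ `ord₂ #(Q'/ω_nQ')` grows linearly ⟹ (index theorem + Herbrand) `e_n(X^χ)` grows linearly ⟹ (F)».
The first two arrows are now kernel theorems: `isTorsion_quotient_iff_exists_proj_ne_zero_of_lattice` (`…RankOneCertificate`) and
`natCard_quotient_omega_eq_mul_pow_of_quotient_torsion` (`…GrowthCertificate`).  This file COMPOSES them into ONE statement, doing the transport between the
two quotients `V_∞/⟨ū_∞⟩` (where the certificate concludes) and `Q'/pQ'`, `Q' = Ē^χ/Λ'u_∞` (where the growth lemma starts):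

* `exists_surjective_linearMap_of_ker_le` — a surjection `q : E ↠ V` with `ker q ⊆ N` factors `E ↠ E/N` through `V`.
* `torsion_quotient_transfer` — along `E ↠ V_∞ = E/pE` (compatible `k⟦X⟧`-structures): if `V_∞/⟨q u⟩` is `k⟦X⟧`-torsion then so is `(E/⟨u⟩)/p`.
* **`natCard_quotient_omega_eq_mul_pow_of_exists_proj_ne_zero`** — lattice `Ē^χ ↪ Λ'` (non-zero), `2 = p` prime of finite multiplicities with `(p) ⊆ Jac`,
  reduction `φ : Λ' ↠ k⟦X⟧` with `φ T = X`, `V_∞ = Ē^χ/p` and `Q'/pQ'` with compatible structures, the squares-dichotomy tower and projections, `u_∞ ∈ Ē^χ`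
  over `ū_∞`: **`(∃ m, ū_m ≠ 0) ⟹ ∃ n₂ c, ∀ n ≥ n₂, #(Q'/ω_nQ') = #(Q'/ω_{n₂}Q')·c^{n−n₂}`**.
* **`classicalMuVanishes_of_comparison`** — the END of the chain in tree currency: linear growth (module side, discharged here) + the arithmetic
  comparison `e_n(κ) ≤ ord_p #(Q'/ω_nQ') + C` + Iwasawa's class-number growth fact ⟹ `ClassicalMuVanishes κ` (tree
  `classicalMuVanishes_of_classNumberPExp_le_linear`).

[folklore]
-/

set_option autoImplicit false
-- the Theorems namespace of this sub repeats the summit name by design (D-0017 nested layout)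
set_option linter.dupNamespace false

open scoped Pointwise

namespace Summit.BirchSwinnertonDyer.BirchSwinnertonDyer.Theorems.SignedMuAtTwo.NonsquareDescent

/-! ## §1 Transport between `V_∞/⟨ū_∞⟩` and `Q'/pQ'` -/

section Transfer

variable {R : Type*} [CommRing R] {E : Type*} [AddCommGroup E] [Module R E]
  {V : Type*} [AddCommGroup V] [Module R V]

/-- A surjection `q : E ↠ V` whose kernel lies in `N` factors the quotient map: there is a surjective `R`-linear `τ : V → E/N` with `τ (q e) = [e]`.
[folklore] -/
theorem exists_surjective_linearMap_of_ker_le (q : E →ₗ[R] V) (hq : Function.Surjective q) (N : Submodule R E)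
    (hker : LinearMap.ker q ≤ N) :
    ∃ τ : V →ₗ[R] E ⧸ N, Function.Surjective τ ∧ ∀ e : E, τ (q e) = N.mkQ e := by
  refine ⟨((LinearMap.ker q).liftQ N.mkQ (by rwa [Submodule.ker_mkQ])).comp (q.quotKerEquivOfSurjective hq).symm.toLinearMap,
    fun x => ?_, fun e => ?_⟩
  · obtain ⟨e, rfl⟩ := Submodule.mkQ_surjective N x
    refine ⟨q e, ?_⟩
    rw [LinearMap.comp_apply, LinearEquiv.coe_coe, LinearMap.quotKerEquivOfSurjective_symm_apply, Submodule.liftQ_apply]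
  · rw [LinearMap.comp_apply, LinearEquiv.coe_coe, LinearMap.quotKerEquivOfSurjective_symm_apply, Submodule.liftQ_apply]

variable {S : Type*} [CommRing S]

/-- **Torsion transfers from `V/⟨q u⟩` to `(E/⟨u⟩)/cE`.**  `q : E ↠ V` `R`-linear with `ker q ⊆ cE`, `φ : R ↠ S` surjective, compatible `S`-structures on `V`
and on `(E/⟨u⟩)/c`: if every class of `V ⧸ S∙(q u)` is `S`-torsion, so is every element of `(E ⧸ R∙u) ⧸ c•⊤`. [folklore] -/
theorem torsion_quotient_transfer [Module S V] (φ : R →+* S) (hφs : Function.Surjective φ)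
    (hV : ∀ (r : R) (v : V), r • v = φ r • v)
    (q : E →ₗ[R] V) (hq : Function.Surjective q) (c : R) (hker : ∀ e : E, q e = 0 → ∃ y : E, e = c • y) (u : E)
    [Module S ((E ⧸ Submodule.span R {u}) ⧸ (c • (⊤ : Submodule R (E ⧸ Submodule.span R {u}))))]
    (hQ : ∀ (r : R) (x : (E ⧸ Submodule.span R {u}) ⧸ (c • (⊤ : Submodule R (E ⧸ Submodule.span R {u})))), r • x = φ r • x)
    (htor : ∀ x : V ⧸ Submodule.span S {q u}, ∃ b : S, b ≠ 0 ∧ b • x = 0) :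
    ∀ x : (E ⧸ Submodule.span R {u}) ⧸ (c • (⊤ : Submodule R (E ⧸ Submodule.span R {u}))), ∃ b : S, b ≠ 0 ∧ b • x = 0 := by
  -- the composite `E ↠ (E/⟨u⟩)/c` has kernel `⟨u⟩ + cE ⊇ ker q`
  set N : Submodule R E := LinearMap.ker ((c • (⊤ : Submodule R (E ⧸ Submodule.span R {u}))).mkQ.comp (Submodule.span R {u}).mkQ) with hN
  have hkerN : LinearMap.ker q ≤ N := by
    intro e he
    obtain ⟨y, rfl⟩ := hker e he
    rw [hN, LinearMap.mem_ker, LinearMap.comp_apply, map_smul, Submodule.mkQ_apply, Submodule.mkQ_apply,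
      Submodule.Quotient.mk_eq_zero]
    exact Submodule.smul_mem_pointwise_smul _ c ⊤ Submodule.mem_top
  obtain ⟨τ, hτs, hτ⟩ := exists_surjective_linearMap_of_ker_le q hq N hkerN
  -- `E/N ≃ (E/⟨u⟩)/c`
  have hsurj2 : Function.Surjective ((c • (⊤ : Submodule R (E ⧸ Submodule.span R {u}))).mkQ.comp (Submodule.span R {u}).mkQ) :=
    (Submodule.mkQ_surjective _).comp (Submodule.mkQ_surjective _)
  let ε := LinearMap.quotKerEquivOfSurjective _ hsurj2
  -- the `R`-linear surjection `σ = ε ∘ τ : V ↠ (E/⟨u⟩)/c` kills `q u` and is `S`-linear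
  let σ : V →ₗ[R] (E ⧸ Submodule.span R {u}) ⧸ (c • (⊤ : Submodule R (E ⧸ Submodule.span R {u}))) := ε.toLinearMap.comp τ
  have hσs : Function.Surjective σ := ε.surjective.comp hτs
  have hσu : σ (q u) = 0 := by
    show ε (τ (q u)) = 0
    rw [hτ, Submodule.mkQ_apply, LinearMap.quotKerEquivOfSurjective_apply_mk, LinearMap.comp_apply, Submodule.mkQ_apply,
      Submodule.mkQ_apply, (Submodule.Quotient.mk_eq_zero _).mpr (Submodule.mem_span_singleton_self u), Submodule.Quotient.mk_zero]
  obtain ⟨σS, hσS⟩ := exists_linearMap_of_compatible φ hφs hV hQ σ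
  intro x
  obtain ⟨v, rfl⟩ := hσs x
  obtain ⟨b, hb, hbv⟩ := htor (Submodule.Quotient.mk v)
  refine ⟨b, hb, ?_⟩
  rw [← Submodule.Quotient.mk_smul, Submodule.Quotient.mk_eq_zero, Submodule.mem_span_singleton] at hbv
  obtain ⟨a, ha⟩ := hbv
  rw [← hσS, ← map_smul, ← ha, map_smul, hσS, hσu, smul_zero]

end Transfer

/-! ## §2 The composed implication -/

section Composed

variable {k : Type*} [Field k] [Finite k]
variable (W : ℕ → Type*) [∀ n, AddCommGroup (W n)] [∀ n, Module (PowerSeries k) (W n)]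
variable {R : Type*} [CommRing R] [IsDomain R] {E : Type*} [AddCommGroup E] [Module R E]

/-- **GNS AT ONE LEVEL ⟹ LINEAR GROWTH OF `#(Q'/ω_nQ')`.**  Lattice `ιE : E ↪ R` non-zero (`Ē^χ`), `p` prime as an element of `R` with finite multiplicities
and `(p) ⊆ Jac(R)`, `E` Noetherian; reduction `φ : R ↠ k⟦X⟧` killing exactly `(p)`, `φ T = X`, `k` finite; `V_∞` an `R`-quotient of `E` by at most `pE`
with compatible `k⟦X⟧`-structure, projections `π n` onto the squares-dichotomy tower `(W, d, ι, N, u)` jointly detecting `0`, `u_∞ ∈ E` with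
`π n (q u_∞) = u n`; `Q' = E/⟨u_∞⟩` with a compatible `k⟦X⟧`-structure on `Q'/pQ'`.  Then **one non-square level** (`∃ m, u m ≠ 0`) gives
`∃ n₂ c, ∀ n ≥ n₂, #(Q'/ω_nQ') = #(Q'/ω_{n₂}Q')·c^{n−n₂}`, `ω_n = (1+T)^{pⁿ} − 1`. [folklore] -/
theorem natCard_quotient_omega_eq_mul_pow_of_exists_proj_ne_zero [IsNoetherian R E]
    (d : ℕ → ℕ) (hd : ∀ a, ∃ n, a ≤ d n)
    (ι : ∀ n, W n →ₗ[PowerSeries k] W (n + 1)) (hι : ∀ n, Function.Injective (ι n))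
    (N : ∀ n, W (n + 1) →ₗ[PowerSeries k] W n)
    (hN : ∀ n (v : W (n + 1)), ι n (N n v) = (PowerSeries.X : PowerSeries k) ^ (d n) • v)
    (u : ∀ n, W n) (hu : ∀ n, N n (u (n + 1)) = u n)
    (ιE : E →ₗ[R] R) (hιE : Function.Injective ιE) (hE : ∃ e₀ : E, e₀ ≠ 0)
    (p : ℕ) [Fact p.Prime] (hϖ : Prime (p : R)) (hfin : ∀ a : R, a ≠ 0 → FiniteMultiplicity (p : R) a)
    (hjac : Ideal.span {(p : R)} ≤ (⊥ : Ideal R).jacobson)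
    (φ : R →+* PowerSeries k) (hφs : Function.Surjective φ) (hφ : ∀ r : R, φ r = 0 ↔ (p : R) ∣ r)
    {T : R} (hTX : φ T = PowerSeries.X)
    {Winf : Type*} [AddCommGroup Winf] [Module R Winf] [Module (PowerSeries k) Winf]
    (hcompat : ∀ (r : R) (v : Winf), r • v = φ r • v)
    (q : E →ₗ[R] Winf) (hq : Function.Surjective q) (hker : ∀ e : E, q e = 0 → ∃ y : E, e = (p : R) • y)
    (π : ∀ n, Winf →ₗ[PowerSeries k] W n) (hsep : ∀ v : Winf, (∀ n, π n v = 0) → v = 0)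
    (uE : E) (hπ : ∀ n, π n (q uE) = u n)
    [Module (PowerSeries k) ((E ⧸ Submodule.span R {uE}) ⧸ ((p : R) • (⊤ : Submodule R (E ⧸ Submodule.span R {uE}))))]
    (hQ : ∀ (r : R) (x : (E ⧸ Submodule.span R {uE}) ⧸ ((p : R) • (⊤ : Submodule R (E ⧸ Submodule.span R {uE})))),
      r • x = φ r • x)
    (hGNS : ∃ m, u m ≠ 0) :
    ∃ (n₂ c : ℕ), ∀ n : ℕ, n₂ ≤ n →
      Nat.card ((E ⧸ Submodule.span R {uE}) ⧸
          Ideal.span {(1 + T) ^ (p ^ n) - 1} • (⊤ : Submodule R (E ⧸ Submodule.span R {uE}))) =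
        Nat.card ((E ⧸ Submodule.span R {uE}) ⧸
          Ideal.span {(1 + T) ^ (p ^ n₂) - 1} • (⊤ : Submodule R (E ⧸ Submodule.span R {uE}))) * c ^ (n - n₂) := by
  -- the certificate: `V_∞/⟨ū_∞⟩` is torsion
  have htor := (isTorsion_quotient_iff_exists_proj_ne_zero_of_lattice W d hd ι hι N hN u hu ιE hιE hE hϖ hfin φ hφs hφ
    hcompat q hq hker π hsep (q uE) hπ).mpr hGNS
  -- transport to `Q'/pQ'`
  have htor' := torsion_quotient_transfer φ hφs hcompat q hq (p : R) hker uE hQ htor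
  -- finite generation of `Q'/pQ'` over `k⟦X⟧`
  haveI : Module.Finite (PowerSeries k)
      ((E ⧸ Submodule.span R {uE}) ⧸ ((p : R) • (⊤ : Submodule R (E ⧸ Submodule.span R {uE})))) :=
    moduleFinite_of_compatible φ hQ ((p : R) • (⊤ : Submodule R (E ⧸ Submodule.span R {uE}))).mkQ (Submodule.mkQ_surjective _)
  exact natCard_quotient_omega_eq_mul_pow_of_quotient_torsion p hjac T φ hQ hTX htor'

end Composed

/-! ## §3 The end of the chain in tree currency: `ClassicalMuVanishes κ` -/

section MuZero

open Literature.NumberTheory.IwasawaTheory Literature.NumberTheory.EllipticCurves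

variable {R : Type*} [CommRing R] {M : Type*} [AddCommGroup M] [Module R M]

/-- **Linear growth of `ord_p #(Q'/ω_nQ')` + the ARITHMETIC comparison `e_n(κ) ≤ ord_p #(Q'/ω_nQ') + C` ⟹ `μ(κ) = 0`** (under Iwasawa's growth theorem for
class numbers, tree fact `iwasawa1959_classNumberPExp_growth`, via `classicalMuVanishes_of_classNumberPExp_le_linear`).  The comparison (index theorem
`Oukhaba2007.*` + Herbrand/capitulation + `…NormIndexSplit`) is the LEAD's arithmetic input; everything module-theoretic is discharged here: `(p) ⊆ Jac(R)`,
`M` f.g. with `T^{N₀}M ⊆ pM` («`μ(Q') = 0`», e.g. from `T_pow_smul_top_le_of_mkQ_torsion` and the S3 (c) certificate), bounded `p`-power torsion, finite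
quotients `M/ω_nM`. [folklore] -/
theorem classicalMuVanishes_of_comparison [Module.Finite R M] (p : ℕ) [Fact p.Prime] (T : R)
    (hjac : Ideal.span {(p : R)} ≤ (⊥ : Ideal R).jacobson) (N₀ : ℕ)
    (hT : Ideal.span {T ^ N₀} • (⊤ : Submodule R M) ≤ Ideal.span {(p : R)} • ⊤)
    (k : ℕ) (htor : ∀ (x : M) (i : ℕ), ((p : R) ^ i) • x = 0 → ((p : R) ^ k) • x = 0)
    (hfin : ∀ n : ℕ, Finite (M ⧸ Ideal.span {(1 + T) ^ (p ^ n) - 1} • (⊤ : Submodule R M)))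
    (hI : iwasawa1959_classNumberPExp_growth)
    {K : Type} [Field K] [NumberField K] (κ : ZpExtension K p) {C n₃ : ℕ}
    (hcmp : ∀ n : ℕ, n₃ ≤ n →
      classNumberPExp κ n ≤ padicValNat p (Nat.card (M ⧸ Ideal.span {(1 + T) ^ (p ^ n) - 1} • (⊤ : Submodule R M))) + C) :
    ClassicalMuVanishes κ := by
  obtain ⟨n₂, d, b, hlin⟩ := padicValNat_natCard_quotient_omega_linear p T hjac N₀ hT k htor hfin
  refine classicalMuVanishes_of_classNumberPExp_le_linear hI κ (a := d) (b := b + C) (n₀ := max n₂ n₃) fun n hn => ?_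
  have h1 := hcmp n (le_trans (le_max_right _ _) hn)
  have h2 := hlin n (le_trans (le_max_left _ _) hn)
  rw [h2] at h1
  have h3 : d * (n - n₂) ≤ d * n := Nat.mul_le_mul_left d (Nat.sub_le n n₂)
  calc classNumberPExp κ n ≤ d * (n - n₂) + b + C := h1
    _ ≤ d * n + b + C := Nat.add_le_add_right (Nat.add_le_add_right h3 b) C
    _ = d * n + (b + C) := Nat.add_assoc _ _ _

end MuZero

end Summit.BirchSwinnertonDyer.BirchSwinnertonDyer.Theorems.SignedMuAtTwo.NonsquareDescent
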